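import Mathlib
import Summits.Ventures.PercRepro.TriangleCapRowA1Five
import Summits.Ventures.PercRepro.TriangleCapRowA2CapSix
import Summits.Ventures.PercRepro.TriangleCapRowA2CapFive
import Summits.Ventures.PercRepro.TriangleCapRowA2Witness
import Summits.Ventures.PercRepro.TriangleCapRowA2FiveCore

/-!
# PercRepro — THE ROW `r = a + 2` ON EVERY ROW `5 ≤ a ≤ 18`, WITH THE ROW `a = 5` AT ITS OWN GAP: the non-bipartite gap
on `(k, a, a + 2)` is `min (2k + 2a − 14) (2k + 4a − 26)` — the triple broom for `a ≥ 6`, the one-triangle family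
`tFamilyGen (k − 1) 5 4` at `2k − 6` for `a = 5` (the two tie at `a = 6`) (p3, gen 48; part 201f)

The finer mixed reads of part 201b hold verbatim for `a ≥ 5` (part 201f′, the primed arithmetic of part 201e), and
so does the whole assembly below the cap (`rowA2_second_order_nocap`: every read is at the triple-broom gap `2k + 2a − 14`).
Only the cap distinguishes the rows: `cap_A2_gen'` (`a ≥ 6`) holds the triple-broom gap, `cap_A2_five` (`a = 5`) only
the one-triangle gap `2k − 6`, and the one-triangle family does sit there. `rowA2_second_order_min`,
`rowA2_nonbip_second_best_min`: the non-`a`-bipartite second-best value on `(k, a, a + 2)` is EXACTLY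
`m k − (a + 2)(k − a − 3) − min (2k + 2a − 14) (2k + 4a − 26)` for every `5 ≤ a ≤ 18`, `3a + 2 ≤ k`;
`second_best_A2_cell'`: the second-best value of the cherry table on the cell is `closed − 2a`. Axioms: standard.
-/

namespace PercRepro

namespace TriangleCap

namespace C047

open Finset

variable {V : Type*} [Fintype V] [DecidableEq V]

/-- **THE ROW `r = a + 2` BELOW THE CAP, `5 ≤ a ≤ 18`, `3a + 2 ≤ k`:** `K₄⁻`-free, `m + (a + 2) = a (k − a)`, no vertex
of degree `k − a` ⇒ `a`-bipartite or `Σ_v d(v)² + (a + 2)(k − 1 − (a + 2)) + (2k + 2a − 14) ≤ m k` (the whole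
assembly of part 201c except the cap, for every row `a ≥ 5`: at `a = 5` the cap alone holds the one-triangle family
`2k − 6`, everything else is at `2k − 4`). -/
theorem rowA2_second_order_nocap (D : SimpleGraph V) [DecidableRel D.Adj] (hK : K4mFree D) (a : ℕ)
    (ha5 : 5 ≤ a) (ha18 : a ≤ 18) (hk : 3 * a + 2 ≤ Fintype.card V)
    (hm : D.edgeFinset.card + (a + 2) = a * (Fintype.card V - a)) (hx : ∀ x, deg D x + a ≠ Fintype.card V) :
    (∃ A : Finset V, A.card = a ∧ BipSub D A) ∨
      ∑ v, deg D v * deg D v + (a + 2) * (Fintype.card V - 1 - (a + 2)) + (2 * Fintype.card V + 2 * a - 14) ≤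
        D.edgeFinset.card * Fintype.card V := by
  have hk2 : 2 * a + 2 ≤ Fintype.card V := by omega
  -- (A) no vertex at the cap
  have hcap : ∀ v, deg D v + a ≤ Fintype.card V := fun v =>
    deg_add_le_card_of_dense D hK a (by omega) (by omega)
      (cap_arith a (Fintype.card V) D.edgeFinset.card (a + 2) (by omega) (by omega)
        (below_cap_arith a (Fintype.card V) D.edgeFinset.card (a + 2) (by omega) hm)) v
  have hcap' : ∀ v, deg D v + a + 1 ≤ Fintype.card V := fun v => by
    have h1 := hcap v
    have h2 := hx v
    omega
  have hcap2 : ∀ v, deg D v ≤ (Fintype.card V - a - 2) + 1 := fun v => by have := hcap' v; omega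
  -- (B) every degree `≥ a`: the window
  by_cases hdeg : ∀ v, a ≤ deg D v
  · exact Or.inr (rowA2_window D a (by omega) hk hm hcap' hdeg)
  push Not at hdeg
  obtain ⟨z, hz⟩ := hdeg
  -- the deletion bookkeeping: `D − z` on `(k − 1, a, d + 2)`
  have hK' := k4mFree_del D hK z
  have hcard' := card_del z
  have hedges' := card_edges_del D z
  have hsq := sum_deg_sq_del D z
  have hT := sum_del_nbhd_le D z (Fintype.card V - a - 2) hcap2
  obtain ⟨T, hTdef⟩ : ∃ T, ∑ w : {v : V // v ≠ z}, (if D.Adj w.1 z then deg (del D z) w else 0) = T := ⟨_, rfl⟩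
  obtain ⟨S', hS'def⟩ : ∃ S', ∑ w : {v : V // v ≠ z}, deg (del D z) w * deg (del D z) w = S' := ⟨_, rfl⟩
  obtain ⟨m', hm'def⟩ : ∃ m', (del D z).edgeFinset.card = m' := ⟨_, rfl⟩
  rw [hTdef, hS'def] at hsq
  rw [hTdef] at hT
  rw [hm'def] at hedges'
  have hcardV' : Fintype.card {v : V // v ≠ z} = Fintype.card V - 1 := by omega
  have hm' : (del D z).edgeFinset.card + (deg D z + 2) = a * (Fintype.card {v : V // v ≠ z} - a) := by
    rw [hm'def, hcardV']
    exact below_cell_edges a (a + 2) (deg D z + 2) (deg D z) (Fintype.card V) D.edgeFinset.card m' hk2 (by omega)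
      hedges' hm
  have hmd : m' + deg D z + (a + 2) = a * (Fintype.card V - a) := by omega
  have hside : ∀ A' : Finset {v : V // v ≠ z}, A'.card = a → BipSub (del D z) A' →
      (∃ A : Finset V, A.card = a ∧ BipSub D A) ∨
        (∑ v, deg D v * deg D v + (a + 2) * (Fintype.card V - 1 - (a + 2)) + (2 * Fintype.card V + 2 * a - 14) ≤
          D.edgeFinset.card * Fintype.card V) ∨
        (2 ≤ deg D z ∧ T + (Fintype.card V - a - 2) ≤ deg D z * (Fintype.card V - a - 2) + a) := by
    intro A' hA'card hB
    have := sides_A2_gen D a (by omega) hk hm z (by omega) A' hA'card hB hm' hcap2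
    rw [hTdef] at this
    exact this
  rcases Nat.lt_or_ge (deg D z + 4) a with hd5 | hd5
  · -- `d ≤ a − 5`: a `B2` cell `(k − 1, a, d + 2)`
    rcases below_second_order_all (del D z) hK' a (deg D z + 2) (by omega) ha18 (by omega) (by omega) hm'
      with ⟨A', hA'card, hB⟩ | hgap
    · rcases hside A' hA'card hB with h | h | ⟨h2, hT'⟩
      · exact Or.inl h
      · exact Or.inr h
      · right
        have hS := sum_deg_sq_le_of_bipSub (del D z) A' hB a (deg D z + 2) hA'card hm' (by omega)
        rw [hS'def, hm'def, hcardV'] at hS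
        rw [hsq, ← hedges']
        exact rowA2_mixed a (deg D z) (Fintype.card V) m' S' T (by omega) h2 (by omega) hk hmd hS hT'
    · right
      rw [hS'def, hm'def, hcardV'] at hgap
      rw [hsq, ← hedges']
      exact rowA2_del_B2 a (deg D z) (Fintype.card V) m' S' T (by omega) (by omega) hk hmd hgap hT
  · rcases Nat.lt_or_ge (deg D z + 3) a with hd4 | hd4
    · -- `d = a − 4`: the `T` cell
      have hda : deg D z = a - 4 := by omega
      have hr' : deg D z + 2 = a - 2 := by omega
      rw [hr'] at hm'
      rw [hda] at hT hedges' hmd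
      rcases rowT_second_order_gen (del D z) hK' a (a - 2) (by omega) ha18 (by omega) (by omega) hm'
        with ⟨A', hA'card, hB⟩ | hgap
      · rw [← hr'] at hm'
        rcases hside A' hA'card hB with h | h | ⟨h2, hT'⟩
        · exact Or.inl h
        · exact Or.inr h
        · right
          have hS := sum_deg_sq_le_of_bipSub (del D z) A' hB a (deg D z + 2) hA'card hm' (by omega)
          rw [hS'def, hm'def, hcardV'] at hS
          rw [hda] at hT' h2 hS
          rw [hsq, ← hedges', hda]
          exact rowA2_mixed a (a - 4) (Fintype.card V) m' S' T (by omega) h2 (by omega) hk hmd hS hT'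
      · right
        rw [hS'def, hm'def, hcardV'] at hgap
        rw [hsq, ← hedges', hda]
        exact rowA2_del_T a (Fintype.card V) m' S' T (by omega) hk hmd hgap hT
    · rcases Nat.lt_or_ge (deg D z + 2) a with hd3 | hd3
      · -- `d = a − 3`: the `B2` cell `r′ = a − 1`
        have hda : deg D z = a - 3 := by omega
        have hr' : deg D z + 2 = a - 1 := by omega
        rw [hr'] at hm'
        rw [hda] at hT hedges' hmd
        rcases rowB_second_order_all (del D z) hK' a (a - 1) (by omega) ha18 (by omega) (by omega) hm'
          with ⟨A', hA'card, hB⟩ | hgap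
        · rw [← hr'] at hm'
          rcases hside A' hA'card hB with h | h | ⟨h2, hT'⟩
          · exact Or.inl h
          · exact Or.inr h
          · right
            have hS := sum_deg_sq_le_of_bipSub (del D z) A' hB a (deg D z + 2) hA'card hm' (by omega)
            rw [hS'def, hm'def, hcardV'] at hS
            rw [hda] at hT' h2 hS
            rw [hsq, ← hedges', hda]
            exact rowA2_mixed a (a - 3) (Fintype.card V) m' S' T (by omega) h2 (by omega) hk hmd hS hT'
        · right
          rw [hS'def, hm'def, hcardV'] at hgap
          rw [hsq, ← hedges', hda]
          exact rowA2_del_B a (Fintype.card V) m' S' T (by omega) hk hmd hgap hT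
      · rcases Nat.lt_or_ge (deg D z + 1) a with hd2 | hd2
        · -- `d = a − 2`: the cell `r′ = a` and the finer mixed read
          have hda : deg D z = a - 2 := by omega
          have hm'a : (del D z).edgeFinset.card + a = a * (Fintype.card {v : V // v ≠ z} - a) := by
            have h := hm'
            rw [hda] at h
            have e : a - 2 + 2 = a := by omega
            rw [e] at h
            exact h
          rcases rowA_second_order_gen (del D z) hK' a (by omega) ha18 (by omega) hm'a
            with ⟨A', hA'card, hB⟩ | hgap
          · by_cases hall : ∀ w : {v : V // v ≠ z}, D.Adj w.1 z → w ∈ A'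
            · obtain ⟨B, hBcard, hBsub⟩ := bipSub_lift D z A' hB hall
              exact Or.inl ⟨B, by rw [hBcard, hA'card], hBsub⟩
            push Not at hall
            obtain ⟨w₀, hw₀z, hw₀A⟩ := hall
            by_cases hnone : ∀ w : {v : V // v ≠ z}, D.Adj w.1 z → w ∉ A'
            · exact Or.inr (rowA2_alloff D a (by omega) hk hm z (by omega) A' hA'card hB hm' hnone w₀ hw₀z)
            push Not at hnone
            obtain ⟨w₁, hw₁z, hw₁A⟩ := hnone
            exact Or.inr (rowA2_last_mixed_two' D hK a ha5 hk hm z hda A' hA'card hB hm' hcap2 w₀ hw₀A hw₀z w₁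
              hw₁A hw₁z)
          · right
            rw [hS'def, hm'def, hcardV'] at hgap
            rw [hda] at hT hedges' hmd
            rw [hsq, ← hedges', hda]
            exact rowA2_del_A a (Fintype.card V) m' S' T (by omega) hk hmd hgap hT
        · -- `d = a − 1`: the cell `r′ = a + 1` and the finer mixed read
          have hda : deg D z = a - 1 := by omega
          have hm'a : (del D z).edgeFinset.card + (a + 1) = a * (Fintype.card {v : V // v ≠ z} - a) := by
            have h := hm'
            rw [hda] at h
            have e : a - 1 + 2 = a + 1 := by omega
            rw [e] at h
            exact h
          rcases rowA1_second_order_gen'' (del D z) hK' a (by omega) ha18 (by omega) hm'a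
            with ⟨A', hA'card, hB⟩ | hgap
          · by_cases hall : ∀ w : {v : V // v ≠ z}, D.Adj w.1 z → w ∈ A'
            · obtain ⟨B, hBcard, hBsub⟩ := bipSub_lift D z A' hB hall
              exact Or.inl ⟨B, by rw [hBcard, hA'card], hBsub⟩
            push Not at hall
            obtain ⟨w₀, hw₀z, hw₀A⟩ := hall
            by_cases hnone : ∀ w : {v : V // v ≠ z}, D.Adj w.1 z → w ∉ A'
            · exact Or.inr (rowA2_alloff D a (by omega) hk hm z (by omega) A' hA'card hB hm' hnone w₀ hw₀z)
            push Not at hnone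
            obtain ⟨w₁, hw₁z, hw₁A⟩ := hnone
            exact Or.inr (rowA2_last_mixed_one' D hK a ha5 hk hm z hda A' hA'card hB hm' hcap2 w₀ hw₀A hw₀z w₁
              hw₁A hw₁z)
          · right
            rw [hS'def, hm'def, hcardV'] at hgap
            rw [hda] at hT hedges' hmd
            rw [hsq, ← hedges', hda]
            exact rowA2_del_A1 a (Fintype.card V) m' S' T (by omega) hk hmd hgap hT

/-- **THE ROW `r = a + 2` ON EVERY ROW `5 ≤ a ≤ 18`, `3a + 2 ≤ k`, AT THE GAP `min (2k + 2a − 14) (2k + 4a − 26)`:**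
`K₄⁻`-free, `m + (a + 2) = a (k − a)` ⇒ `a`-bipartite or
`Σ_v d(v)² + (a + 2)(k − 1 − (a + 2)) + min (2k + 2a − 14) (2k + 4a − 26) ≤ m k`. -/
theorem rowA2_second_order_min (D : SimpleGraph V) [DecidableRel D.Adj] (hK : K4mFree D) (a : ℕ)
    (ha5 : 5 ≤ a) (ha18 : a ≤ 18) (hk : 3 * a + 2 ≤ Fintype.card V)
    (hm : D.edgeFinset.card + (a + 2) = a * (Fintype.card V - a)) :
    (∃ A : Finset V, A.card = a ∧ BipSub D A) ∨
      ∑ v, deg D v * deg D v + (a + 2) * (Fintype.card V - 1 - (a + 2)) +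
          min (2 * Fintype.card V + 2 * a - 14) (2 * Fintype.card V + 4 * a - 26) ≤
        D.edgeFinset.card * Fintype.card V := by
  by_cases hx : ∃ x, deg D x + a = Fintype.card V
  · obtain ⟨x, hx⟩ := hx
    rcases Nat.lt_or_ge a 6 with ha | ha
    · -- `a = 5`: the cap at the one-triangle gap `2k − 6`
      have ha5' : a = 5 := by omega
      rcases cap_A2_five D hK a ha5 (by omega) hk hm x hx with h | h
      · exact Or.inl h
      · right
        have hmin : min (2 * Fintype.card V + 2 * a - 14) (2 * Fintype.card V + 4 * a - 26) =
            2 * Fintype.card V - 6 := by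
          rw [ha5']
          omega
        rw [hmin]
        exact h
    · rcases cap_A2_gen' D hK a ha hk hm x hx with h | h
      · exact Or.inl h
      · right
        have hmin : min (2 * Fintype.card V + 2 * a - 14) (2 * Fintype.card V + 4 * a - 26) =
            2 * Fintype.card V + 2 * a - 14 := by omega
        rw [hmin]
        exact h
  · push Not at hx
    rcases rowA2_second_order_nocap D hK a ha5 ha18 hk hm hx with h | h
    · exact Or.inl h
    · right
      have hmin : min (2 * Fintype.card V + 2 * a - 14) (2 * Fintype.card V + 4 * a - 26) ≤
          2 * Fintype.card V + 2 * a - 14 := min_le_left _ _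
      omega

/-- **THE ROW `a = 5` AT `r = 7`, `17 ≤ k`:** `K₄⁻`-free, `m + 7 = 5 (k − 5)` ⇒ `5`-bipartite or
`Σ_v d(v)² + 7 (k − 8) + (2k − 6) ≤ m k` — the one-triangle gap, below the triple broom's `2k − 4`. -/
theorem rowA2_second_order_five (D : SimpleGraph V) [DecidableRel D.Adj] (hK : K4mFree D)
    (hk : 17 ≤ Fintype.card V) (hm : D.edgeFinset.card + 7 = 5 * (Fintype.card V - 5)) :
    (∃ A : Finset V, A.card = 5 ∧ BipSub D A) ∨
      ∑ v, deg D v * deg D v + 7 * (Fintype.card V - 1 - 7) + (2 * Fintype.card V - 6) ≤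
        D.edgeFinset.card * Fintype.card V := by
  rcases rowA2_second_order_min D hK 5 (le_refl 5) (by omega) (by omega) hm with h | h
  · exact Or.inl h
  · right
    have hmin : min (2 * Fintype.card V + 2 * 5 - 14) (2 * Fintype.card V + 4 * 5 - 26) =
        2 * Fintype.card V - 6 := by omega
    rw [hmin] at h
    exact h

/-- **THE NON-BIPARTITE SECOND-BEST VALUE ON THE CELL `(k, a, a + 2)` FOR EVERY `5 ≤ a ≤ 18`, `3a + 2 ≤ k`:** EXACTLY
`m k − (a + 2)(k − a − 3) − min (2k + 2a − 14) (2k + 4a − 26)`, attained by the triple broom (`a ≥ 6`) or by the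
one-triangle family `tFamilyGen (k − 1) 5 4` (`a = 5`). -/
theorem rowA2_nonbip_second_best_min (k a : ℕ) (ha5 : 5 ≤ a) (ha18 : a ≤ 18) (hk : 3 * a + 2 ≤ k) :
    (∀ (D : SimpleGraph (Fin k)) [DecidableRel D.Adj], K4mFree D → D.edgeFinset.card + (a + 2) = a * (k - a) →
        (¬ ∃ A : Finset (Fin k), A.card = a ∧ BipSub D A) →
        ∑ v, deg D v * deg D v + (a + 2) * (k - 1 - (a + 2)) + min (2 * k + 2 * a - 14) (2 * k + 4 * a - 26) ≤
          D.edgeFinset.card * k) ∧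
      ∃ (D : SimpleGraph (Fin k)) (_ : DecidableRel D.Adj), K4mFree D ∧ D.edgeFinset.card + (a + 2) = a * (k - a) ∧
        (¬ ∃ A : Finset (Fin k), A.card = a ∧ BipSub D A) ∧
        ∑ v, deg D v * deg D v + (a + 2) * (k - 1 - (a + 2)) + min (2 * k + 2 * a - 14) (2 * k + 4 * a - 26) =
          D.edgeFinset.card * k := by
  have hcard : Fintype.card (Fin k) = k := Fintype.card_fin k
  refine ⟨?_, ?_⟩
  · intro D _ hK hm hnb
    rcases rowA2_second_order_min D hK a ha5 ha18 (by rw [hcard]; exact hk) (by rw [hcard]; exact hm) with h | h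
    · exact absurd h hnb
    · rw [hcard] at h
      exact h
  · rcases Nat.lt_or_ge a 6 with ha | ha
    · -- `a = 5`: the one-triangle family
      have ha5' : a = 5 := by omega
      subst ha5'
      have hmin : min (2 * k + 2 * 5 - 14) (2 * k + 4 * 5 - 26) = 2 * k - 6 := by omega
      rw [hmin]
      obtain ⟨n, rfl⟩ : ∃ n, k = n + 1 := ⟨k - 1, by omega⟩
      obtain ⟨hK, hE, hS, hnb⟩ := tFamilyGen_value n 5 4 (by omega) (by omega) (by omega)
      refine ⟨tFamilyGen n 5 4 (by omega), inferInstance, hK, ?_, fun ⟨A, _, hB⟩ => hnb A hB, ?_⟩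
      · have e : 4 + 5 - 2 = 5 + 2 := by omega
        rw [e] at hE
        exact hE
      · have e : 4 + 5 - 2 = 5 + 2 := by omega
        rw [e] at hS
        have e2 : 2 * (n - 2 * 5) + 2 * 4 * (5 - 3) = 2 * (n + 1) - 6 := by omega
        rw [← e2, ← add_assoc]
        exact hS
    · have hmin : min (2 * k + 2 * a - 14) (2 * k + 4 * a - 26) = 2 * k + 2 * a - 14 := by omega
      rw [hmin]
      obtain ⟨hK, hE, hnb, hS⟩ := rowA2_witness k a (by omega) (by omega) (by omega) (by omega) (by omega) (by omega)
      exact ⟨_, inferInstance, hK, hE, hnb, hS⟩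

/-- **THE SECOND-BEST VALUE OF THE CHERRY TABLE ON THE CELL `(k, a, a + 2)`, `5 ≤ a ≤ 18`, `3a + 2 ≤ k`:**
`closed − 2a` (the brooms of the `a`-side): the `a`-bipartite graphs are `≥ 2a` below unless they miss a star (then
extremal), the others `≥ min (2k + 2a − 14) (2k + 4a − 26) ≥ 2a` below. -/
theorem second_best_A2_cell' (k a : ℕ) (ha5 : 5 ≤ a) (ha18 : a ≤ 18) (hk : 3 * a + 2 ≤ k) :
    (∀ (D : SimpleGraph (Fin k)) [DecidableRel D.Adj], K4mFree D → D.edgeFinset.card + (a + 2) = a * (k - a) →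
        ∑ v, deg D v * deg D v + (a + 2) * (k - 1 - (a + 2)) ≠ D.edgeFinset.card * k →
        ∑ v, deg D v * deg D v + (a + 2) * (k - 1 - (a + 2)) + 2 * a ≤ D.edgeFinset.card * k) ∧
      ∃ (D : SimpleGraph (Fin k)) (_ : DecidableRel D.Adj), K4mFree D ∧ D.edgeFinset.card + (a + 2) = a * (k - a) ∧
        ∑ v, deg D v * deg D v + (a + 2) * (k - 1 - (a + 2)) + 2 * a = D.edgeFinset.card * k := by
  have hcard : Fintype.card (Fin k) = k := Fintype.card_fin k
  refine ⟨?_, ?_⟩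
  · intro D _ hK hm hne
    rcases rowA2_second_order_min D hK a ha5 ha18 (by rw [hcard]; exact hk) (by rw [hcard]; exact hm)
      with ⟨A, hAcard, hB⟩ | h
    · by_cases hstar : ∃ v, MissingStar D A v
      · obtain ⟨v, hv⟩ := hstar
        have h := closed_form_eq_of_missingStar D A hB hv a (a + 2) hAcard (by rw [hcard]; exact hm)
          (by rw [hcard]; omega)
        rw [hcard] at h
        exact absurd h hne
      · have h := closed_form_stability_bipSub D A hB a (a + 2) hAcard (by rw [hcard]; exact hm)
          (by rw [hcard]; omega) (by omega) hstar
        rw [hcard] at h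
        have e : 2 * (a + 2 - 2) = 2 * a := by omega
        rw [e] at h
        exact h
    · rw [hcard] at h
      have hmin : 2 * a ≤ min (2 * k + 2 * a - 14) (2 * k + 4 * a - 26) := by
        apply le_min <;> omega
      omega
  · obtain ⟨D, inst, A, hK, hAcard, hB, hns, hE, hS⟩ := broom_value k a (a + 2) (by omega) (by omega) (by omega)
    have hr' : a + 2 ≤ a * (k - a) := by
      have h1 : 2 ≤ k - a := by omega
      have h2 : a * 2 ≤ a * (k - a) := Nat.mul_le_mul_left a h1
      omega
    have hE' : D.edgeFinset.card + (a + 2) = a * (k - a) := by rw [hE]; omega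
    refine ⟨D, inst, hK, hE', ?_⟩
    rw [hE]
    have e : 2 * (a + 2 - 2) = 2 * a := by omega
    rw [e] at hS
    exact hS

end C047

end TriangleCap

end PercRepro
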